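import Mathlib
import Summits.NavierStokesRegularity.NavierStokesRegularity.Theorems.EulerZoomLiouvillePowerGaugeEulerLiouvilleDSSSwirlCasimir
import Summits.NavierStokesRegularity.NavierStokesRegularity.Theorems.EulerZoomLiouvillePowerGaugeEulerLiouvilleAxisymDSSPow
import Literature.Analysis.FluidPDE.BackwardParticleMap
import Literature.Analysis.FluidPDE.FlatSwirlGauge
import Literature.Analysis.FluidPDE.VorticityCalculus
import Literature.Analysis.ODE.EvolutionMapAutonomous
import HarnessLib

/-!
# Crux E `PowerGaugeEulerLiouville` (stmt-NavierStokesRegularity-19832): the SYMMETRY-FREE DSS vorticity-support stratum with a ONE-SLICE hypothesis — a classical DSS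
# member whose VORTICITY SUPPORT HAS FINITE VOLUME ON ONE past slice is trivial (width seat ns-ezl-w3 g3)

Route №10 `EulerZoomLiouville` (NavierStokesRegularity), crux E; LEAD ns-typeII-p2 g12; the DSS branch of `stub_nonSelfSimilarRest` (`IsDSSClassicalTame ρ u p`:
classical `ν = 0` solution on `(−∞,0)`, `l`-DSS, `u`/`∇u` bounded on compact past intervals, and one of several tameness alternatives).  The tree's symmetry-free
vorticity-support strata (ns-typeII-p3: `IsDSSCompactVorticity` / `dss_ae_eq_zero_of_compactSupport_vorticity`, and `VorticitySupport.ae_eq_zero_of_gauge_of_dss_vorticitySupport`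
in `…DSSVorticitySupport.lean`) ask for the support measure to be BOUNDED ON COMPACT TIME INTERVALS, because their conservation law
(`volume_vorticitySupport_eq_of_classical`, `IsVorticitySolutionOn.volume_support_vorticity_eq`) is proved in Eulerian variables ("no particle trajectories").  The tree now
HAS the Lagrangian flow under the Cauchy–Lipschitz hypotheses (`ODE.evolutionMap`; MB §1.3/§1.6 `ParticleTrajectoryMeasurePreserving`, `BackwardParticleMap`), and
`…DSSSwirlCasimir` (p646151) moved measure preservation to the past window; so the hypothesis drops to ONE SLICE, with NO symmetry:

* HELMHOLTZ (`curl_eq_zero_of_curl_evolutionMap_eq_zero`): the Eulerian Cauchy formula `ω(x,t) = ∇X · ω₀(X⁻¹x)` (`IsClassicalNSSolutionOn.curl_eq_fderiv_evolutionMap_apply`,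
  time-shifted so that the base slice is any `τ < 0`) ⇒ `ω(τ, φ(t → τ) x) = 0 ⇒ ω(t, x) = 0` for all `t, τ < 0`; so `{ω(t,·) ≠ 0} ⊆ φ(t → τ)⁻¹ {ω(τ,·) ≠ 0}` and, the
  two-time maps preserving volume, **`vol{ω(t,·) ≠ 0}` is the same on every past slice** (`volume_vorticitySupport_eq`).
* DSS (`curl_dss`, `volume_vorticitySupport_dss`): `ω(τ, x) = l^{2+ρ} ω(l^{2+ρ}τ, l x)` ⇒ `vol{ω(τ,·) ≠ 0} = l^{−3} · vol{ω(l^{2+ρ}τ,·) ≠ 0}`.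
* Together a finite support volume `V` on one slice satisfies `V = l^{−3} V`, so `V = 0`, the (open) support is empty, and every slice is irrotational
  (`curl_slice_eq_zero_of_dss_of_finiteVorticitySupport`); the member vanishes by `AxisymNoSwirl.ae_eq_zero_of_gauge_of_curl_slice_eq_zero` (`A`-gauge, `ρ > −1`).
* MEMBER FORM `ae_eq_zero_of_gauge_of_dss_finiteVorticitySupport`: the common binders of `IsDSSClassicalTame` (`hns`, `hl`, `hdss`, `hbdd`) +
  `∃ τ₀ < 0, vol{y | curl (u τ₀) y ≠ 0} < ⊤` ⇒ `u = 0` a.e. (= `VorticitySupport.ae_eq_zero_of_gauge_of_dss_vorticitySupport` with its locally-uniform `hsupp` replaced by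
  one slice).  For the LEAD: a symmetry-free one-slice alternative of `IsDSSClassicalTame` (⊇ compact vorticity support on one slice).

WHAT THIS IS NOT: not NS regularity, not the crux E — one more DSS stratum of the crux CLASS 19832 (MODEL lattice; E/NS strata) `--supports` stmt-19832; DSS members with
vorticity of infinite-volume support (the generic case) are untouched; 19832 OPEN.
[cite: MajdaBertozziCUP2002, §1.6 Prop. 1.8 eq. (1.51), §2.5 (2.115)–(2.117), §1.3 Prop. 1.4; ChaeShvydkoy2013, §4 (Chae's support argument)]
-/

noncomputable section

-- flat `Theorems/<Route><Decl>…` files of one crux share the namespace of the crux (tree convention: `Summit.<S>.<S>.…`)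
set_option linter.dupNamespace false

open MeasureTheory Set Filter Topology Metric Function InnerProductSpace
open scoped RealInnerProductSpace NNReal ENNReal ContDiff

namespace Summit.NavierStokesRegularity.NavierStokesRegularity.Theorems.PowerGaugeEulerLiouville

open Literature.Analysis Literature.Analysis.FluidPDE Literature.Analysis.FunctionSpaces

namespace DSSVorticitySupport

open DSSSwirlRatchet

variable {u : ℝ → EuclideanSpace ℝ (Fin 3) → EuclideanSpace ℝ (Fin 3)} {p : ℝ → EuclideanSpace ℝ (Fin 3) → ℝ}

/-! ### Helmholtz: the zero set of the vorticity is transported (Cauchy formula, any base slice) -/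

/-- **`ω(τ, φ(t → τ) x) = 0 ⇒ ω(t, x) = 0`** for a classical Euler solution on `(−∞,0)` with the Cauchy–Lipschitz hypotheses (`t, τ < 0`): the Eulerian Cauchy
formula `ω(x, t) = ∇X(X⁻¹x) · ω(X⁻¹x, τ)` from the base slice `τ` (the tree's `curl_eq_fderiv_evolutionMap_apply` after the time shift `s ↦ s + τ`).
[cite: MajdaBertozziCUP2002, §1.6 Prop. 1.8 eq. (1.51); §2.5 (2.115)–(2.117)] -/
theorem curl_eq_zero_of_curl_evolutionMap_eq_zero (hns : IsClassicalNSSolutionOn (Iio 0) 0 0 u p)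
    (hL : ODE.IsUniformlyLipschitzOn u (Iio 0)) {τ t : ℝ} (hτ : τ < 0) (ht : t < 0) (x : EuclideanSpace ℝ (Fin 3))
    (h0 : curl (u τ) (ODE.evolutionMap u t τ x) = 0) : curl (u t) x = 0 := by
  have hS : ((· + τ) ⁻¹' Iio (0 : ℝ)) = Iio (-τ) := by
    ext s; simp only [mem_preimage, mem_Iio]; constructor <;> intro h <;> linarith
  have hns' : IsClassicalEulerSolutionOn (Iio (-τ)) 0 (fun s => u (s + τ)) (fun s => p (s + τ)) := by
    have h := hns.comp_add_right τ
    rw [hS] at h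
    exact h
  have hL' : ODE.IsUniformlyLipschitzOn (fun s => u (s + τ)) (Iio (-τ)) := hS ▸ isUniformlyLipschitzOn_comp_add_right hL τ
  have h0S : (0 : ℝ) ∈ Iio (-τ) := by simp only [mem_Iio]; linarith
  have htS : t - τ ∈ Iio (-τ) := by simp only [mem_Iio]; linarith
  have hform := IsClassicalNSSolutionOn.curl_eq_fderiv_evolutionMap_apply hns' (convex_Iio _) h0S (uniqueDiffOn_Iio _) hL' htS x
  have hΦ : ODE.evolutionMap (fun s => u (s + τ)) (t - τ) 0 x = ODE.evolutionMap u t τ x := by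
    obtain ⟨K, hK⟩ := hL.exists_lipschitzWith_uIcc (convex_Iio 0) ht hτ
    rw [ODE.evolutionMap_comp_add_right τ (K := K) (by simpa only [sub_add_cancel, zero_add] using hK) x]
    simp only [sub_add_cancel, zero_add]
  simp only [sub_add_cancel, zero_add] at hform
  rw [hΦ, h0, map_zero] at hform
  exact hform

/-- The vorticity support of a later/earlier slice sits inside the preimage of the base slice's support under the two-time map. [cite: MajdaBertozziCUP2002, §1.6 Prop. 1.8] -/
theorem vorticitySupport_subset_preimage (hns : IsClassicalNSSolutionOn (Iio 0) 0 0 u p)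
    (hL : ODE.IsUniformlyLipschitzOn u (Iio 0)) {τ t : ℝ} (hτ : τ < 0) (ht : t < 0) :
    {x : EuclideanSpace ℝ (Fin 3) | curl (u t) x ≠ 0} ⊆ ODE.evolutionMap u t τ ⁻¹' {a | curl (u τ) a ≠ 0} :=
  fun x hx h0 => hx (curl_eq_zero_of_curl_evolutionMap_eq_zero hns hL hτ ht x h0)

/-- The vorticity support of a slice of a classical solution is open. [folklore] -/
theorem isOpen_vorticitySupport (hns : IsClassicalNSSolutionOn (Iio 0) 0 0 u p) {τ : ℝ} (hτ : τ < 0) :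
    IsOpen {x : EuclideanSpace ℝ (Fin 3) | curl (u τ) x ≠ 0} :=
  isOpen_ne_fun (contDiff_curl (n := 0) ((hns.contDiff_velocity hτ).of_le (by norm_cast))).continuous continuous_const

/-- **The volume of the vorticity support is the same on every past slice** (`t, τ < 0`): inclusion in the preimage under the measure-preserving `φ(t → τ)`, both ways.
[cite: MajdaBertozziCUP2002, §1.6 Prop. 1.8 + §1.3 Prop. 1.4] -/
theorem volume_vorticitySupport_eq (hns : IsClassicalNSSolutionOn (Iio 0) 0 0 u p)
    (hL : ODE.IsUniformlyLipschitzOn u (Iio 0)) {τ t : ℝ} (hτ : τ < 0) (ht : t < 0) :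
    volume {x : EuclideanSpace ℝ (Fin 3) | curl (u t) x ≠ 0} = volume {x : EuclideanSpace ℝ (Fin 3) | curl (u τ) x ≠ 0} := by
  refine le_antisymm ?_ ?_
  · exact (measure_mono (vorticitySupport_subset_preimage hns hL hτ ht)).trans_eq
      ((measurePreserving_evolutionMap_past hns hL ht hτ).measure_preimage (isOpen_vorticitySupport hns hτ).measurableSet.nullMeasurableSet)
  · exact (measure_mono (vorticitySupport_subset_preimage hns hL ht hτ)).trans_eq
      ((measurePreserving_evolutionMap_past hns hL hτ ht).measure_preimage (isOpen_vorticitySupport hns ht).measurableSet.nullMeasurableSet)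

/-! ### DSS scaling of the vorticity support -/

/-- **DSS scaling of the vorticity**: `u(τ, y) = l^{1+ρ} u(l^{2+ρ}τ, l y)` ⇒ `ω(τ, x) = l^{2+ρ} · ω(l^{2+ρ}τ, l x)` (`curl` of `k • v(c ·)` is `kc • (curl v)(c ·)`). [folklore] -/
theorem curl_dss {ρ : ℝ} {l : ℝ}
    (hdss : ∀ τ : ℝ, τ < 0 → ∀ y, u τ y = (l ^ (1 + ρ)) • u ((l ^ (2 + ρ)) * τ) (l • y))
    {τ : ℝ} (hτ : τ < 0) (x : EuclideanSpace ℝ (Fin 3)) :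
    curl (u τ) x = (l ^ (1 + ρ) * l) • curl (u ((l ^ (2 + ρ)) * τ)) (l • x) := by
  have hfun : u τ = fun y => (l ^ (1 + ρ)) • u ((l ^ (2 + ρ)) * τ) (l • y) := funext fun y => hdss τ hτ y
  rw [hfun, curl_smul_comp_smul]

/-- **`vol{ω(τ,·) ≠ 0} = l^{−3} · vol{ω(l^{2+ρ}τ,·) ≠ 0}`**: the support at time `τ` is the `l`-homothetic preimage of the support at the earlier time `l^{2+ρ}τ`. [folklore] -/
theorem volume_vorticitySupport_dss {ρ : ℝ} {l : ℝ} (hl : 1 < l)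
    (hdss : ∀ τ : ℝ, τ < 0 → ∀ y, u τ y = (l ^ (1 + ρ)) • u ((l ^ (2 + ρ)) * τ) (l • y))
    {τ : ℝ} (hτ : τ < 0) :
    volume {x : EuclideanSpace ℝ (Fin 3) | curl (u τ) x ≠ 0} =
      ENNReal.ofReal ((l ^ (3 : ℕ))⁻¹) * volume {x : EuclideanSpace ℝ (Fin 3) | curl (u ((l ^ (2 + ρ)) * τ)) x ≠ 0} := by
  have hl0 : 0 < l := by linarith
  have hk : l ^ (1 + ρ) * l ≠ 0 := mul_ne_zero (Real.rpow_pos_of_pos hl0 _).ne' hl0.ne'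
  have hset : {x : EuclideanSpace ℝ (Fin 3) | curl (u τ) x ≠ 0} =
      (fun x : EuclideanSpace ℝ (Fin 3) => l • x) ⁻¹' {w | curl (u ((l ^ (2 + ρ)) * τ)) w ≠ 0} := by
    ext x
    simp only [mem_setOf_eq, mem_preimage, curl_dss hdss hτ x, smul_ne_zero_iff, ne_eq, hk, not_false_eq_true, true_and]
  rw [hset, Measure.addHaar_preimage_smul volume hl0.ne', finrank_euclideanSpace_fin, abs_of_pos (inv_pos.2 (pow_pos hl0 3))]

/-! ### The kill -/

/-- **FINITE-VOLUME VORTICITY SUPPORT ON ONE SLICE ⇒ EVERY SLICE IRROTATIONAL** (classical `l`-DSS member on `(−∞,0)`, Cauchy–Lipschitz hypotheses): with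
`σ₀ = l^{2+ρ}τ₀`, `V(σ₀) = V(τ₀) = l^{−3} V(σ₀)` finite ⇒ `V(σ₀) = 0` ⇒ the open support is empty ⇒ Helmholtz carries `ω ≡ 0` to every slice.
[cite: MajdaBertozziCUP2002, §1.6 Prop. 1.8; ChaeShvydkoy2013, §4] -/
theorem curl_slice_eq_zero_of_dss_of_finiteVorticitySupport {ρ : ℝ} (hns : IsClassicalNSSolutionOn (Iio 0) 0 0 u p)
    (hL : ODE.IsUniformlyLipschitzOn u (Iio 0)) {l : ℝ} (hl : 1 < l)
    (hdss : ∀ τ : ℝ, τ < 0 → ∀ y, u τ y = (l ^ (1 + ρ)) • u ((l ^ (2 + ρ)) * τ) (l • y))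
    {τ₀ : ℝ} (hτ₀ : τ₀ < 0) (hfin : volume {x : EuclideanSpace ℝ (Fin 3) | curl (u τ₀) x ≠ 0} < ⊤) :
    ∀ τ : ℝ, τ < 0 → ∀ x, curl (u τ) x = 0 := by
  have hl0 : 0 < l := by linarith
  have hσ₀ : (l ^ (2 + ρ)) * τ₀ < 0 := mul_neg_of_pos_of_neg (Real.rpow_pos_of_pos hl0 _) hτ₀
  set V : ℝ≥0∞ := volume {x : EuclideanSpace ℝ (Fin 3) | curl (u τ₀) x ≠ 0} with hV
  -- `V = l^{-3} V`
  have hlaw : V = ENNReal.ofReal ((l ^ (3 : ℕ))⁻¹) * V := by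
    have h1 := volume_vorticitySupport_dss hl hdss hτ₀
    rwa [volume_vorticitySupport_eq hns hL hτ₀ hσ₀] at h1
  have hV0 : V = 0 := by
    by_contra hne
    have hpos : 0 < V.toReal := ENNReal.toReal_pos hne hfin.ne
    have h2 := congrArg ENNReal.toReal hlaw
    rw [ENNReal.toReal_mul, ENNReal.toReal_ofReal (inv_nonneg.2 (pow_nonneg hl0.le 3))] at h2
    have hlt : (l ^ (3 : ℕ))⁻¹ < 1 := inv_lt_one_of_one_lt₀ (one_lt_pow₀ hl three_ne_zero)
    nlinarith
  -- the base slice is irrotational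
  have hbase : ∀ x, curl (u τ₀) x = 0 := by
    have hempty := ((isOpen_vorticitySupport hns hτ₀).measure_eq_zero_iff volume).1 (hV ▸ hV0)
    intro x
    by_contra hx
    have : x ∈ {y : EuclideanSpace ℝ (Fin 3) | curl (u τ₀) y ≠ 0} := hx
    rw [hempty] at this
    exact this
  intro τ hτ x
  exact curl_eq_zero_of_curl_evolutionMap_eq_zero hns hL hτ₀ hτ x (hbase _)

end DSSVorticitySupport

/-! ### Member form -/

namespace DSSVorticitySupport

open DSSSwirlRatchet

variable {u : ℝ → EuclideanSpace ℝ (Fin 3) → EuclideanSpace ℝ (Fin 3)} {p : ℝ → EuclideanSpace ℝ (Fin 3) → ℝ}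
  {H : ℝ → EuclideanSpace ℝ (Fin 3) → EuclideanSpace ℝ (Fin 3) →L[ℝ] EuclideanSpace ℝ (Fin 3)} {c : ℝ≥0}

/-- **MEMBER FORM: CLASSICAL DSS MEMBER WITH VORTICITY SUPPORT OF FINITE VOLUME ON ONE PAST SLICE ⇒ TRIVIAL** — no symmetry.  Binders: the common part of
`IsDSSClassicalTame` (`hns` classical on `(−∞,0)`, `hl`, `hdss`, `hbdd`: `u`/`∇u` bounded on compact past intervals, giving the Cauchy–Lipschitz hypotheses) and
`hfin : ∃ τ₀ < 0, vol{y | curl (u τ₀) y ≠ 0} < ⊤`.  Irrotational slices by `curl_slice_eq_zero_of_dss_of_finiteVorticitySupport`, then the `A`-gauge endgame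
`AxisymNoSwirl.ae_eq_zero_of_gauge_of_curl_slice_eq_zero`. [cite: MajdaBertozziCUP2002, §1.6 Prop. 1.8; ChaeShvydkoy2013, §4] -/
theorem ae_eq_zero_of_gauge_of_dss_finiteVorticitySupport {ρ : ℝ} (hρ : 0 < ρ)
    (hH : HasWeakSpatialGradientOn (slab (EuclideanSpace ℝ (Fin 3)) (Iio 0) isOpen_Iio) u H)
    (hc : ∀ a : ℝ, 0 < a → ENNReal.ofReal (a ^ (2 * ρ)) * cknA a (0 : ℝ × EuclideanSpace ℝ (Fin 3)) u +
        ENNReal.ofReal (a ^ ρ) * cknE a (0 : ℝ × EuclideanSpace ℝ (Fin 3)) H +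
        ENNReal.ofReal (a ^ (2 * ρ)) * cknD a (0 : ℝ × EuclideanSpace ℝ (Fin 3)) p ≤ (c : ℝ≥0∞))
    (hns : IsClassicalNSSolutionOn (Iio 0) 0 0 u p)
    {l : ℝ} (hl : 1 < l)
    (hdss : ∀ τ : ℝ, τ < 0 → ∀ y, u τ y = (l ^ (1 + ρ)) • u ((l ^ (2 + ρ)) * τ) (l • y))
    (hbdd : ∀ s t : ℝ, s < t → t < 0 → ∃ B : ℝ, ∀ τ ∈ Icc s t, ∀ y,
      ‖u τ y‖ ≤ B ∧ ‖fderiv ℝ (u τ) y‖ ≤ B)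
    (hfin : ∃ τ₀ : ℝ, τ₀ < 0 ∧ volume {y : EuclideanSpace ℝ (Fin 3) | curl (u τ₀) y ≠ 0} < ⊤) :
    uncurry u =ᵐ[volume.restrict (Iio (0 : ℝ) ×ˢ (univ : Set (EuclideanSpace ℝ (Fin 3))))] 0 := by
  obtain ⟨τ₀, hτ₀, hV⟩ := hfin
  exact AxisymNoSwirl.ae_eq_zero_of_gauge_of_curl_slice_eq_zero (by linarith) hH hc hns
    (curl_slice_eq_zero_of_dss_of_finiteVorticitySupport hns (isUniformlyLipschitzOn_of_bounds hns hbdd) hl hdss hτ₀ hV)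

end DSSVorticitySupport

end Summit.NavierStokesRegularity.NavierStokesRegularity.Theorems.PowerGaugeEulerLiouville

end
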